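import Summits.SmoothPoincare4.SmoothPoincare4.Theorems.RootDecompAEDoublesBeyondShadowTwoLedgerDefs

/-!
# Grade-four ownership ledger `LocalTableLE4 → GradeFourDichotomy` for KMN encoding graphs, part 4/15: the block calculus read in `F₅`

§4 The list-level word operations of the block calculus as statements about `Block.toFG5`: `toFG5_freeReduce` (free
reduction is the identity of `F₅`), `isConj_toFG5_cycStrip` / `isConj_toFG5_cycReduce` (cyclic reduction stays in the
conjugacy class), `toFG5_winv`, `isConj_toFG5_substitute` (list substitution = `Roe.substHom` up to conjugacy),
`expSum_eq_expo`, and the letters of the output words.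

THE FAMILY (14 modules `Theorems/RootDecompAEDoublesBeyondShadowTwoLedger*.lean` + the closing module
`Theorems/RootDecompAEDoublesBeyondShadowTwoStubLedgerFour.lean`, one namespace
`Summit.SmoothPoincare4.SmoothPoincare4.Theorems.RootDecompAEDoublesBeyondShadowTwoStubLedgerFour`, linearly chained
imports, split by topic to respect the 400-line bound on proof files).
-/

open Function
open Literature.Topology.FourManifolds

set_option linter.dupNamespace false

noncomputable section

namespace Summit.SmoothPoincare4.SmoothPoincare4.Theorems.RootDecompAEDoublesBeyondShadowTwoStubLedgerFour

/-! ## §4 The block calculus, read in the free group `F₅`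

Semantics of the list-level word operations of the twinned block calculus (`freeReduce`, `cycStrip`, `cycReduce`, `winv`,
`substitute`, `splitAt`, `expSum`) as statements about `Block.toFG5`. -/

namespace Block

/-- The letter map of `toFG5`: reduce the letter index modulo `5`, keep the sign. -/
def l5 (g : ℕ × Bool) : Fin 5 × Bool := (⟨g.1 % 5, Nat.mod_lt _ (by norm_num)⟩, g.2)

/-- The `F₅`-letter of a letter index. -/
def f5 (x : ℕ) : Fin 5 := ⟨x % 5, Nat.mod_lt _ (by norm_num)⟩

/-- `toFG5` is `FreeGroup.mk` after the letter map. -/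
theorem toFG5_eq (w : List (ℕ × Bool)) : toFG5 w = FreeGroup.mk (w.map l5) := rfl

/-- `toFG5` of a concatenation. -/
theorem toFG5_append (u v : List (ℕ × Bool)) : toFG5 (u ++ v) = toFG5 u * toFG5 v := by
  rw [toFG5_eq, toFG5_eq, toFG5_eq, List.map_append, FreeGroup.mul_mk]

/-- `toFG5` of a cons. -/
theorem toFG5_cons (g : ℕ × Bool) (w : List (ℕ × Bool)) : toFG5 (g :: w) = toFG5 [g] * toFG5 w := by
  rw [← toFG5_append]; rfl

/-- `toFG5` of the empty word. -/
@[simp] theorem toFG5_nil : toFG5 [] = 1 := rfl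

/-- A one-letter word: the generator or its inverse. -/
theorem toFG5_single (g : ℕ × Bool) :
    toFG5 [g] = if g.2 then FreeGroup.of (f5 g.1) else (FreeGroup.of (f5 g.1))⁻¹ := by
  rw [toFG5_eq]
  rcases g with ⟨a, b⟩
  cases b
  · simp only [List.map, l5, f5, Bool.false_eq_true, if_false]
    rw [FreeGroup.of, FreeGroup.inv_mk]; rfl
  · rfl

/-- Two adjacent letters with the same index and opposite signs cancel. -/
theorem toFG5_pair_cancel (g g' : ℕ × Bool) (h1 : g.1 = g'.1) (h2 : g.2 ≠ g'.2) : toFG5 [g, g'] = 1 := by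
  rw [show [g, g'] = [g] ++ [g'] from rfl, toFG5_append, toFG5_single, toFG5_single, ← h1]
  cases hb : g.2 <;> cases hb' : g'.2 <;> simp_all

/-- Inverse word. -/
theorem toFG5_winv (w : List (ℕ × Bool)) : toFG5 (winv w) = (toFG5 w)⁻¹ := by
  rw [toFG5_eq, toFG5_eq, FreeGroup.inv_mk, winv, FreeGroup.invRev, List.map_reverse, List.map_map, List.map_map]
  rfl

/-- Free reduction does not change the element. -/
theorem toFG5_freeReduce (w : List (ℕ × Bool)) : toFG5 (freeReduce w) = toFG5 w := by
  unfold freeReduce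
  -- The step function is kept abstract (`F` with its two defining equations) so that the proof does not
  -- restate the `match` of `freeReduce` (a restated `match` compiles to a different auxiliary matcher in
  -- this module than in the module declaring `freeReduce`, and `simpa` cannot identify the two).
  have key : ∀ (F : List (ℕ × Bool) → (ℕ × Bool) → List (ℕ × Bool)),
      (∀ x, F [] x = [x]) →
      (∀ y rest x, F (y :: rest) x = if y.1 = x.1 ∧ y.2 ≠ x.2 then rest else x :: y :: rest) →
      ∀ (v acc : List (ℕ × Bool)), toFG5 (v.foldl F acc).reverse = toFG5 (acc.reverse ++ v) := by
    intro F hF0 hF1 v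
    induction v with
    | nil => intro acc; simp
    | cons x v ih =>
      intro acc
      rw [List.foldl_cons, ih]
      cases acc with
      | nil => rw [hF0]; simp
      | cons y rest =>
        rw [hF1]
        split_ifs with hc
        · rw [List.reverse_cons, List.append_assoc, List.singleton_append, toFG5_append, toFG5_append,
            toFG5_cons y, toFG5_cons x, ← mul_assoc (toFG5 [y]), ← toFG5_append [y] [x],
            show [y] ++ [x] = [y, x] from rfl, toFG5_pair_cancel y x hc.1 hc.2, one_mul]
        · simp [List.reverse_cons, List.append_assoc]
  refine (key _ ?_ ?_ w []).trans (by simp)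
  · intro x; rfl
  · intro y rest x; rfl

/-- A word is conjugate to any of its rotations `v ++ u ~ u ++ v`. -/
theorem isConj_toFG5_append_comm (u v : List (ℕ × Bool)) : IsConj (toFG5 (u ++ v)) (toFG5 (v ++ u)) := by
  rw [toFG5_append, toFG5_append, isConj_iff]
  exact ⟨(toFG5 u)⁻¹, by group⟩

/-- `cycStrip` on the empty word. -/
theorem cycStrip_succ_nil (n : ℕ) : cycStrip (n + 1) [] = [] := by
  simp [cycStrip]

/-- `cycStrip` on a nonempty word: strip the two end letters if they cancel (and something remains), else stop. -/
theorem cycStrip_succ_cons (n : ℕ) (x : ℕ × Bool) (rest : List (ℕ × Bool)) :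
    cycStrip (n + 1) (x :: rest) =
      if rest ≠ [] ∧ x.1 = ((x :: rest).getLast (List.cons_ne_nil x rest)).1 ∧
          x.2 ≠ ((x :: rest).getLast (List.cons_ne_nil x rest)).2
      then cycStrip n rest.dropLast else x :: rest := by
  have hl : (x :: rest).getLast? = some ((x :: rest).getLast (List.cons_ne_nil x rest)) :=
    List.getLast?_eq_some_getLast _
  conv_lhs => unfold cycStrip
  simp only [hl]

/-- Stripping cancelling end letters stays in the conjugacy class. -/
theorem isConj_toFG5_cycStrip : ∀ (n : ℕ) (w : List (ℕ × Bool)), IsConj (toFG5 (cycStrip n w)) (toFG5 w)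
  | 0, w => by rw [cycStrip]
  | n + 1, [] => by rw [cycStrip_succ_nil]
  | n + 1, x :: rest => by
    rw [cycStrip_succ_cons]
    split_ifs with hc
    · obtain ⟨hne, h1, h2⟩ := hc
      refine (isConj_toFG5_cycStrip n rest.dropLast).trans ?_
      set y := (x :: rest).getLast (List.cons_ne_nil x rest) with hy
      have hw : x :: rest = [x] ++ rest.dropLast ++ [y] := by
        have := List.dropLast_append_getLast (List.cons_ne_nil x rest)
        rw [List.dropLast_cons_of_ne_nil hne] at this
        simpa using this.symm
      rw [hw, toFG5_append, toFG5_append, isConj_iff]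
      refine ⟨toFG5 [x], ?_⟩
      have hxy : toFG5 [y] = (toFG5 [x])⁻¹ := by
        rw [← mul_eq_one_iff_eq_inv', ← toFG5_append, show [x] ++ [y] = [x, y] from rfl]
        exact toFG5_pair_cancel x y h1 h2
      rw [hxy]
    · exact IsConj.refl _

/-- Cyclic reduction stays in the conjugacy class. -/
theorem isConj_toFG5_cycReduce (w : List (ℕ × Bool)) : IsConj (toFG5 (cycReduce w)) (toFG5 w) := by
  unfold cycReduce
  simpa only [toFG5_freeReduce] using isConj_toFG5_cycStrip (freeReduce w).length (freeReduce w)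

/-- SMALL words: all letter indices `< 5` (then `toFG5` is injective on letters). -/
def Small (w : List (ℕ × Bool)) : Prop := ∀ g ∈ w, g.1 < 5

/-- On indices `< 5` the letter map is injective. -/
theorem f5_inj {x y : ℕ} (hx : x < 5) (hy : y < 5) (h : f5 x = f5 y) : x = y := by
  have := congrArg Fin.val h
  simp only [f5] at this
  rwa [Nat.mod_eq_of_lt hx, Nat.mod_eq_of_lt hy] at this

/-- The value of an index `< 5`. -/
@[simp] theorem f5_val {x : ℕ} (hx : x < 5) : (f5 x : ℕ) = x := Nat.mod_eq_of_lt hx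

/-- SUBSTITUTION `x ↦ V`, read in `F₅`: the lift sending `x` to `toFG5 V` and fixing the other letters. -/
theorem toFG5_flatMap_subst (w V : List (ℕ × Bool)) (x : ℕ) (hw : Small w) (hx : x < 5) :
    toFG5 (w.flatMap fun g => if g.1 = x then (if g.2 then V else winv V) else [g]) =
      FreeGroup.lift (fun y => if y = f5 x then toFG5 V else FreeGroup.of y) (toFG5 w) := by
  induction w with
  | nil => simp
  | cons g w ih =>
    have hg : g.1 < 5 := hw g (by simp)
    rw [List.flatMap_cons, toFG5_append, ih (fun g' hg' => hw g' (by simp [hg'])), toFG5_cons, map_mul]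
    congr 1
    rw [toFG5_single]
    by_cases hgx : g.1 = x
    · rw [if_pos hgx, hgx]
      cases g.2
      · simp [toFG5_winv]
      · simp
    · have hne : f5 g.1 ≠ f5 x := fun h => hgx (f5_inj hg hx h)
      rw [if_neg hgx, toFG5_single]
      cases g.2
      · simp [hne]
      · simp [hne]

/-- SUBSTITUTION of the block calculus, read in `F₅`: conjugate to `substHom x (toFG5 W)` of the word (`V = W⁻¹`). -/
theorem isConj_toFG5_substitute (w W : List (ℕ × Bool)) (x : ℕ) (hw : Small w) (hx : x < 5) :
    IsConj (toFG5 (substitute w x (winv W))) (Roe.substHom (f5 x) (toFG5 W) (toFG5 w)) := by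
  unfold substitute
  refine (isConj_toFG5_cycReduce _).trans ?_
  rw [toFG5_flatMap_subst w (winv W) x hw hx, toFG5_winv]
  exact IsConj.refl _

/-- EXPONENT SUMS of the block calculus are the `F₅` exponent sums (small words, index `< 5`). -/
theorem expSum_eq_expo (w : List (ℕ × Bool)) (x : ℕ) (hw : Small w) (hx : x < 5) :
    expSum w x = expo (f5 x) (toFG5 w) := by
  unfold expSum
  suffices h : ∀ (v : List (ℕ × Bool)) (a : ℤ), Small v →
      v.foldl (fun a g => if g.1 = x then (if g.2 then a + 1 else a - 1) else a) a = a + expo (f5 x) (toFG5 v) by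
    simpa using h w 0 hw
  intro v
  induction v with
  | nil => intro a _; simp
  | cons g v ih =>
    intro a hv
    have hg : g.1 < 5 := hv g (by simp)
    rw [List.foldl_cons, ih _ (fun g' hg' => hv g' (by simp [hg'])), toFG5_cons, expo_mul, toFG5_single]
    by_cases hgx : g.1 = x
    · rw [if_pos hgx, hgx]
      cases g.2 <;> simp <;> ring
    · have hne : f5 g.1 ≠ f5 x := fun h => hgx (f5_inj hg hx h)
      rw [if_neg hgx]
      cases g.2 <;> simp [hne]

/-! ### Letters of the output words -/

/-- The letters of `freeReduce w` are letters of `w`. -/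
theorem mem_freeReduce {w : List (ℕ × Bool)} {g : ℕ × Bool} (h : g ∈ freeReduce w) : g ∈ w := by
  unfold freeReduce at h
  suffices hs : ∀ (v acc : List (ℕ × Bool)) (g : ℕ × Bool),
      g ∈ v.foldl (fun acc x => match acc with
        | y :: rest => if y.1 = x.1 ∧ y.2 ≠ x.2 then rest else x :: y :: rest
        | [] => [x]) acc → g ∈ acc ∨ g ∈ v by
    simpa using hs w [] g (List.mem_reverse.mp h)
  intro v
  induction v with
  | nil => intro acc g hg; exact Or.inl hg
  | cons x v ih =>
    intro acc g hg
    rw [List.foldl_cons] at hg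
    rcases ih _ g hg with h' | h'
    · cases acc with
      | nil => simp at h'; simp [h']
      | cons y rest =>
        simp only at h'
        split_ifs at h' with hc
        · exact Or.inl (by simp [h'])
        · simp only [List.mem_cons] at h' ⊢; tauto
    · exact Or.inr (by simp [h'])

/-- The letters of `cycStrip n w` are letters of `w`. -/
theorem mem_cycStrip : ∀ {n : ℕ} {w : List (ℕ × Bool)} {g : ℕ × Bool}, g ∈ cycStrip n w → g ∈ w
  | 0, w, g, h => by rwa [cycStrip] at h
  | n + 1, [], g, h => by rwa [cycStrip_succ_nil] at h
  | n + 1, x :: rest, g, h => by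
    rw [cycStrip_succ_cons] at h
    split_ifs at h with hc
    · exact List.mem_cons_of_mem _ (List.dropLast_subset _ (mem_cycStrip h))
    · exact h

/-- The letters of `cycReduce w` are letters of `w`. -/
theorem mem_cycReduce {w : List (ℕ × Bool)} {g : ℕ × Bool} (h : g ∈ cycReduce w) : g ∈ w :=
  mem_freeReduce (mem_cycStrip h)

/-- The letter indices of `winv w` are those of `w`. -/
theorem mem_winv {w : List (ℕ × Bool)} {g : ℕ × Bool} (h : g ∈ winv w) : ∃ g' ∈ w, g'.1 = g.1 := by
  unfold winv at h
  rw [List.mem_reverse, List.mem_map] at h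
  obtain ⟨g', hg', rfl⟩ := h
  exact ⟨g', hg', rfl⟩

/-- The letter indices of `substitute w x V` are indices `≠ x` of `w` or indices of `V`. -/
theorem mem_substitute {w V : List (ℕ × Bool)} {x : ℕ} {g : ℕ × Bool} (h : g ∈ substitute w x V) :
    (∃ g' ∈ w, g'.1 = g.1 ∧ g'.1 ≠ x) ∨ (∃ g' ∈ V, g'.1 = g.1) := by
  unfold substitute at h
  have h' := mem_cycReduce h
  rw [List.mem_flatMap] at h'
  obtain ⟨g', hg', hm⟩ := h'
  by_cases hgx : g'.1 = x
  · rw [if_pos hgx] at hm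
    right
    cases hb : g'.2
    · rw [hb] at hm; simp only [Bool.false_eq_true, if_false] at hm; exact mem_winv hm
    · rw [hb] at hm; simp only [if_true] at hm; exact ⟨g, hm, rfl⟩
  · rw [if_neg hgx, List.mem_singleton] at hm
    subst hm
    exact Or.inl ⟨g, hg', rfl, hgx⟩

end Block

end Summit.SmoothPoincare4.SmoothPoincare4.Theorems.RootDecompAEDoublesBeyondShadowTwoStubLedgerFour
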